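import Mathlib

/-!
# The outer region of the packing-resolvent gain: characteristic form and the barrier (slack) inequalities
# (crux `DenseExcursion`, stmt-AtomisticToContinuum-12586, line `sonic-cavity-renewal` v8, stub `stub_packingResolventW`)

Helper file (`--supports stmt-AtomisticToContinuum-12586`) for the registered stub `stub_packingResolventW` (skeleton v8,
registered helper here: `packingResolventW_outerSlack`). On `x ≥ x_Λ = log(2s₀/Λ)` the real resolvent system
`Λu − Lu = f` is a weakly coupled pair of damped transport equations for the characteristic fields `P = u₁ + 3u₂`,
`M = u₁ − 3u₂`: `c₊P′ = (Λ − b₊₊)P − (b₊₋M + F₊)` (landed `charP_eq`) and `c₋M′ = (Λ − b₋₋)M − (b₋₊P + F₋)`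
(`charM_eq`), `c± = W − 1 ± S`, `b₊₊ = ⅔W′ + 2W − r + 2S′ + 4S`, `b₋₋ = ⅔W′ + 2W − r − 2S′ − 4S`, `b₊₋ = W′/3 + S′ + 2S`,
`b₋₊ = W′/3 − S′ − 2S`, `F± = f₁ ± 3f₂`. The weighted maximum principle (`Literature.Analysis.ODE.barrier_touching`) with
the barriers `P̄ = (N/Λ)(2 + 100S) + ηeˣ`, `M̄ = (N/Λ)(2 + 75S) + ηeˣ` closes as soon as the SLACK inequalities
`(Λ − b₊₊)P̄ − c₊P̄′ − |b₊₋|M̄ ≥ (3/2)N(1 + 4S) − 13η` and `(Λ − b₋₋)M̄ − c₋M̄′ − |b₋₊|P̄ ≥ (3/2)N(1 + 4S) − 13η` hold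
(`N(1 + 4S) ≥ |F±|` for `(1 + S)`-weighted sources of size `N`). They are proved here as real inequalities at one point:

* zone A (`x_Λ ≤ x ≤ 0`, large `S ≤ S(x_Λ) ≈ Λ/2`; atoms `|W| ≤ 1/4`, `|W′| ≤ 1/2`, `|S + S′| = |(eˣS)′|e^{−x} ≤ 11/5` from the
  tube): `outer_BP_zoneA` (needs `175S ≤ 94Λ − 902`, i.e. `ρ₀ = 2`: the coupling `|b₊₋| ≈ S` against the damping
  `Λ − b₊₊ ≈ Λ − 2S`), `outer_BM_zoneA` (`25S ≤ 69Λ − 811`);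
* zone B (`x ≥ 0`, all atoms `≤ B₀`, `W + S ≤ 1` so `c± ≤ 0`, `Λ ≥ 700B₀²`): `outer_BP_zoneB`, `outer_BM_zoneB`;
* `outer_touch_arith`: slack `≥ (3/2)A − J`, `J ≤ A/4` and the touching inequality `θ·slack ≤ A` give `θ ≤ 1`.

Constants validated on `SS(r₂)` by the wave-4 worker (`validate_barrier.py`: zone-A minima `2.12Λ(1+4S)` resp.
`13.8Λ(1+4S)` above `Λ(1+4S)`, against the required `0.5Λ(1+4S)`).
-/

namespace Summit.AtomisticToContinuum.HydrodynamicLimit.Theorems.PackingAnalyticImplosion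

/-- **THE REGULAR CHARACTERISTIC EQUATION WITH SOURCE** (pure algebra, `e₁ − 3e₂`): the real resolvent equations at a
point give `c₋M′ = (Λ − b₋₋)M − (b₋₊P + F₋)` for `M = u₁ − 3u₂`, `P = u₁ + 3u₂`, `c₋ = a − 1 − b`,
`b₋₋ = ⅔a′ + 2a − r − 2b′ − 4b`, `b₋₊ = a′/3 − b′ − 2b`, `F₋ = F₁ − 3F₂`. [folklore] -/
theorem charM_eq (Λ r a a' b b' U₁ U₁' U₂ U₂' F₁ F₂ : ℝ)
    (e1 : Λ * U₁ - ((a - 1) * U₁' + 3 * b * U₂' + (a' + 2 * a - r) * U₁ + (3 * b' + 6 * b) * U₂) = F₁)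
    (e2 : Λ * U₂ - (b / 3 * U₁' + (a - 1) * U₂' + (b' + 2 * b) * U₁ + (a' / 3 + 2 * a - r) * U₂) = F₂) :
    (a - 1 - b) * (U₁' - 3 * U₂') = (Λ - (2 / 3 * a' + 2 * a - r - 2 * b' - 4 * b)) * (U₁ - 3 * U₂) -
      ((a' / 3 - b' - 2 * b) * (U₁ + 3 * U₂) + (F₁ - 3 * F₂)) := by
  linear_combination (-1 : ℝ) * e1 + 3 * e2

/-! ## Zone A: `x_Λ ≤ x ≤ 0` -/

/-- **SLACK OF THE `P`-BARRIER ON ZONE A.** With `P̄ = (N/Λ)(2 + 100S) + ηe`, `M̄ = (N/Λ)(2 + 75S) + ηe` (`e = eˣ ≤ 1`,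
`Se ≤ 1`), `P̄′ = (N/Λ)100S′ + ηe`: `(Λ − b₊₊)P̄ − c₊P̄′ − |b₊₋|M̄ ≥ (3/2)N(1 + 4S) − 13η` as soon as `175S ≤ 94Λ − 902`
(expansion in `τ = S + S′`: the `N`-part is `≥ (N/Λ)(0.5Λ − 271 + S(94Λ − 902 − 175S))`, the `η`-part `≥ −13η`).
[folklore] -/
theorem outer_BP_zoneA {Λ r W W' S S' N η e : ℝ} (hΛ : 1000 ≤ Λ) (hr1 : 1 ≤ r) (hN : 0 < N)
    (hη : 0 ≤ η) (he : 0 < e) (he1 : e ≤ 1) (hSe : S * e ≤ 1) (hS : 0 < S) (hSmax : 175 * S ≤ 94 * Λ - 902)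
    (hW : |W| ≤ 1 / 4) (hW' : |W'| ≤ 1 / 2) (hτ : |S + S'| ≤ 11 / 5) :
    3 / 2 * (N * (1 + 4 * S)) - 13 * η ≤
      (Λ - (2 / 3 * W' + 2 * W - r + 2 * S' + 4 * S)) * (N / Λ * (2 + 100 * S) + η * e)
        - (W - 1 + S) * (N / Λ * (100 * S') + η * e) - |W' / 3 + S' + 2 * S| * (N / Λ * (2 + 75 * S) + η * e) := by
  obtain ⟨hWl, hWu⟩ := abs_le.1 hW
  obtain ⟨hW'l, hW'u⟩ := abs_le.1 hW'
  obtain ⟨hτl, hτu⟩ := abs_le.1 hτ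
  have hΛpos : 0 < Λ := by linarith
  have hNΛ : 0 < N / Λ := div_pos hN hΛpos
  have hb : |W' / 3 + S' + 2 * S| ≤ S + 71 / 30 := by
    have e1 : W' / 3 + S' + 2 * S = W' / 3 + (S + S') + S := by ring
    rw [e1]
    calc _ ≤ |W' / 3| + |S + S'| + |S| := abs_add_three _ _ _
      _ ≤ 1 / 6 + 11 / 5 + S := by
        rw [abs_of_pos hS]
        have : |W' / 3| ≤ 1 / 6 := by rw [abs_div, abs_of_pos (by norm_num : (0:ℝ) < 3)]; linarith
        linarith
      _ = S + 71 / 30 := by ring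
  have hEN : 3 / 2 * Λ * (1 + 4 * S) ≤ (Λ - (2 / 3 * W' + 2 * W - r + 2 * S' + 4 * S)) * (2 + 100 * S)
      - (W - 1 + S) * (100 * S') - (S + 71 / 30) * (2 + 75 * S) := by
    have t1 : -(200 / 3) * (W' * S) ≥ -(100 / 3) * S := by nlinarith
    have t2 : -100 * (W * S) ≥ -25 * S := by nlinarith
    have t3 : 100 * (r * S) ≥ 100 * S := by nlinarith
    have t4 : -300 * ((S + S') * S) ≥ -660 * S := by nlinarith
    have t5 : -100 * (W * (S + S')) ≥ -55 := by nlinarith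
    have t6 : S * (94 * Λ - 902 - 175 * S) ≥ 0 := mul_nonneg hS.le (by linarith)
    nlinarith
  have hEη : -13 ≤ e * ((Λ - (2 / 3 * W' + 2 * W - r + 2 * S' + 4 * S)) - (W - 1 + S) - (S + 71 / 30)) := by
    have t1 : e * Λ ≥ 0 := by positivity
    have t2 : e * (S + S') ≤ 11 / 5 := by nlinarith
    nlinarith
  have hcoup : |W' / 3 + S' + 2 * S| * (N / Λ * (2 + 75 * S) + η * e) ≤ (S + 71 / 30) * (N / Λ * (2 + 75 * S) + η * e) :=
    mul_le_mul_of_nonneg_right hb (by positivity)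
  have h1 : N / Λ * (3 / 2 * Λ * (1 + 4 * S)) = 3 / 2 * (N * (1 + 4 * S)) := by field_simp
  have h2 : N / Λ * (3 / 2 * Λ * (1 + 4 * S)) ≤ N / Λ * ((Λ - (2 / 3 * W' + 2 * W - r + 2 * S' + 4 * S)) * (2 + 100 * S)
          - (W - 1 + S) * (100 * S') - (S + 71 / 30) * (2 + 75 * S)) := mul_le_mul_of_nonneg_left hEN hNΛ.le
  have h3 : η * (-13) ≤ η * (e * ((Λ - (2 / 3 * W' + 2 * W - r + 2 * S' + 4 * S)) - (W - 1 + S) - (S + 71 / 30))) :=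
    mul_le_mul_of_nonneg_left hEη hη
  nlinarith

/-- **SLACK OF THE `M`-BARRIER ON ZONE A**: `(Λ − b₋₋)M̄ − c₋M̄′ − |b₋₊|P̄ ≥ (3/2)N(1 + 4S) − 13η` as soon as
`25S ≤ 69Λ − 811` (the `N`-part is `≥ (N/Λ)(0.5Λ − 220 + S(69Λ − 811 − 25S))`, the `η`-part `≥ −13η`). [folklore] -/
theorem outer_BM_zoneA {Λ r W W' S S' N η e : ℝ} (hΛ : 1000 ≤ Λ) (hr1 : 1 ≤ r) (hN : 0 < N)
    (hη : 0 ≤ η) (he : 0 < e) (he1 : e ≤ 1) (hS : 0 < S) (hSmax : 25 * S ≤ 69 * Λ - 811)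
    (hW : |W| ≤ 1 / 4) (hW' : |W'| ≤ 1 / 2) (hτ : |S + S'| ≤ 11 / 5) :
    3 / 2 * (N * (1 + 4 * S)) - 13 * η ≤
      (Λ - (2 / 3 * W' + 2 * W - r - 2 * S' - 4 * S)) * (N / Λ * (2 + 75 * S) + η * e)
        - (W - 1 - S) * (N / Λ * (75 * S') + η * e) - |W' / 3 - S' - 2 * S| * (N / Λ * (2 + 100 * S) + η * e) := by
  obtain ⟨hWl, hWu⟩ := abs_le.1 hW
  obtain ⟨hW'l, hW'u⟩ := abs_le.1 hW'
  obtain ⟨hτl, hτu⟩ := abs_le.1 hτ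
  have hΛpos : 0 < Λ := by linarith
  have hNΛ : 0 < N / Λ := div_pos hN hΛpos
  have hb : |W' / 3 - S' - 2 * S| ≤ S + 71 / 30 := by
    have e1 : W' / 3 - S' - 2 * S = W' / 3 + -(S + S') + -S := by ring
    rw [e1]
    calc _ ≤ |W' / 3| + |(-(S + S'))| + |(-S)| := abs_add_three _ _ _
      _ ≤ 1 / 6 + 11 / 5 + S := by
        rw [abs_neg, abs_neg, abs_of_pos hS]
        have : |W' / 3| ≤ 1 / 6 := by rw [abs_div, abs_of_pos (by norm_num : (0:ℝ) < 3)]; linarith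
        linarith
      _ = S + 71 / 30 := by ring
  have hEN : 3 / 2 * Λ * (1 + 4 * S) ≤ (Λ - (2 / 3 * W' + 2 * W - r - 2 * S' - 4 * S)) * (2 + 75 * S)
      - (W - 1 - S) * (75 * S') - (S + 71 / 30) * (2 + 100 * S) := by
    have t1 : -50 * (W' * S) ≥ -25 * S := by nlinarith
    have t2 : -150 * (W * S) ≥ -(75 / 2) * S := by nlinarith
    have t3 : 75 * (r * S) ≥ 75 * S := by nlinarith
    have t4 : 150 * ((S + S') * S) ≥ -330 * S := by nlinarith
    have t5 : -75 * (W * (S + S')) ≥ -(165 / 4) := by nlinarith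
    have t6 : 75 * (W * S) ≥ -(75 / 4) * S := by nlinarith
    have t7 : 75 * (S * (S + S')) ≥ -165 * S := by nlinarith
    have t8 : S * (69 * Λ - 811 - 25 * S) ≥ 0 := mul_nonneg hS.le (by linarith)
    nlinarith
  have hEη : -13 ≤ e * ((Λ - (2 / 3 * W' + 2 * W - r - 2 * S' - 4 * S)) - (W - 1 - S) - (S + 71 / 30)) := by
    have t1 : e * Λ ≥ 0 := by positivity
    have t2 : -(11 / 5) ≤ e * (S + S') := by nlinarith
    have t3 : 0 ≤ e * S := by positivity
    nlinarith
  have hcoup : |W' / 3 - S' - 2 * S| * (N / Λ * (2 + 100 * S) + η * e) ≤ (S + 71 / 30) * (N / Λ * (2 + 100 * S) + η * e) :=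
    mul_le_mul_of_nonneg_right hb (by positivity)
  have h1 : N / Λ * (3 / 2 * Λ * (1 + 4 * S)) = 3 / 2 * (N * (1 + 4 * S)) := by field_simp
  have h2 : N / Λ * (3 / 2 * Λ * (1 + 4 * S)) ≤ N / Λ * ((Λ - (2 / 3 * W' + 2 * W - r - 2 * S' - 4 * S)) * (2 + 75 * S)
          - (W - 1 - S) * (75 * S') - (S + 71 / 30) * (2 + 100 * S)) := mul_le_mul_of_nonneg_left hEN hNΛ.le
  have h3 : η * (-13) ≤ η * (e * ((Λ - (2 / 3 * W' + 2 * W - r - 2 * S' - 4 * S)) - (W - 1 - S) - (S + 71 / 30))) :=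
    mul_le_mul_of_nonneg_left hEη hη
  nlinarith

/-! ## Zone B: `x ≥ 0` -/

/-- **SLACK OF THE `P`-BARRIER ON ZONE B** (`x ≥ 0`: all profile atoms `≤ B₀`, `W + S ≤ 1` so the degenerate speed
`c₊ = W − 1 + S ≤ 0`, and `Λ ≥ 700B₀²`): `(Λ − b₊₊)P̄ − c₊P̄′ − |b₊₋|M̄ ≥ (3/2)N(1 + 4S)` (the `η`-part is non-negative).
[folklore] -/
theorem outer_BP_zoneB {Λ r W W' S S' N η e B₀ : ℝ} (hB : 1 ≤ B₀) (hΛ : 700 * B₀ ^ 2 ≤ Λ) (hr1 : 1 ≤ r)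
    (hN : 0 < N) (hη : 0 ≤ η) (he : 0 < e) (hS : 0 < S) (hSB : S ≤ B₀) (hW : |W| ≤ B₀) (hW' : |W'| ≤ B₀) (hS' : |S'| ≤ B₀)
    (hWS : W + S ≤ 1) :
    3 / 2 * (N * (1 + 4 * S)) ≤
      (Λ - (2 / 3 * W' + 2 * W - r + 2 * S' + 4 * S)) * (N / Λ * (2 + 100 * S) + η * e)
        - (W - 1 + S) * (N / Λ * (100 * S') + η * e) - |W' / 3 + S' + 2 * S| * (N / Λ * (2 + 75 * S) + η * e) := by
  obtain ⟨hWl, hWu⟩ := abs_le.1 hW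
  obtain ⟨hW'l, hW'u⟩ := abs_le.1 hW'
  obtain ⟨hS'l, hS'u⟩ := abs_le.1 hS'
  have hB2 : B₀ ≤ B₀ ^ 2 := by nlinarith
  have hΛpos : 0 < Λ := by nlinarith
  have hNΛ : 0 < N / Λ := div_pos hN hΛpos
  have hb : |W' / 3 + S' + 2 * S| ≤ 4 * B₀ := by
    calc _ ≤ |W' / 3| + |S'| + |2 * S| := abs_add_three _ _ _
      _ ≤ 4 * B₀ := by
        rw [abs_of_pos (by positivity : (0:ℝ) < 2 * S)]
        have : |W' / 3| ≤ B₀ / 3 := by rw [abs_div, abs_of_pos (by norm_num : (0:ℝ) < 3)]; linarith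
        linarith
  have hbpp : 2 / 3 * W' + 2 * W - r + 2 * S' + 4 * S ≤ 10 * B₀ := by linarith
  have hEN : 3 / 2 * Λ * (1 + 4 * S) ≤ (Λ - (2 / 3 * W' + 2 * W - r + 2 * S' + 4 * S)) * (2 + 100 * S)
      - (W - 1 + S) * (100 * S') - 4 * B₀ * (2 + 75 * S) := by
    have t1 : (Λ - 10 * B₀) * (2 + 100 * S) ≤ (Λ - (2 / 3 * W' + 2 * W - r + 2 * S' + 4 * S)) * (2 + 100 * S) :=
      mul_le_mul_of_nonneg_right (by linarith) (by positivity)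
    have t2 : |(W - 1 + S) * (100 * S')| ≤ 3 * B₀ * (100 * B₀) := by
      rw [abs_mul]
      refine mul_le_mul (by rw [abs_le]; constructor <;> linarith) ?_ (abs_nonneg _) (by positivity)
      rw [abs_mul, abs_of_pos (by norm_num : (0:ℝ) < 100)]; linarith
    have t2' := (abs_le.1 t2).1
    have t3 : S * (94 * Λ - 1300 * B₀) ≥ 0 := mul_nonneg hS.le (by nlinarith)
    nlinarith
  have hEη : 0 ≤ e * ((Λ - (2 / 3 * W' + 2 * W - r + 2 * S' + 4 * S)) - (W - 1 + S) - 4 * B₀) := by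
    have : 0 ≤ (Λ - (2 / 3 * W' + 2 * W - r + 2 * S' + 4 * S)) - (W - 1 + S) - 4 * B₀ := by nlinarith
    positivity
  have hcoup : |W' / 3 + S' + 2 * S| * (N / Λ * (2 + 75 * S) + η * e) ≤ 4 * B₀ * (N / Λ * (2 + 75 * S) + η * e) :=
    mul_le_mul_of_nonneg_right hb (by positivity)
  have h1 : N / Λ * (3 / 2 * Λ * (1 + 4 * S)) = 3 / 2 * (N * (1 + 4 * S)) := by field_simp
  have h2 : N / Λ * (3 / 2 * Λ * (1 + 4 * S)) ≤ N / Λ * ((Λ - (2 / 3 * W' + 2 * W - r + 2 * S' + 4 * S)) * (2 + 100 * S)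
          - (W - 1 + S) * (100 * S') - 4 * B₀ * (2 + 75 * S)) := mul_le_mul_of_nonneg_left hEN hNΛ.le
  have h3 : 0 ≤ η * (e * ((Λ - (2 / 3 * W' + 2 * W - r + 2 * S' + 4 * S)) - (W - 1 + S) - 4 * B₀)) :=
    mul_nonneg hη hEη
  nlinarith

/-- **SLACK OF THE `M`-BARRIER ON ZONE B**: `(Λ − b₋₋)M̄ − c₋M̄′ − |b₋₊|P̄ ≥ (3/2)N(1 + 4S)` under the same hypotheses
(`−c₋ = 1 − W + S ≥ 2S ≥ 0`). [folklore] -/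
theorem outer_BM_zoneB {Λ r W W' S S' N η e B₀ : ℝ} (hB : 1 ≤ B₀) (hΛ : 700 * B₀ ^ 2 ≤ Λ) (hr1 : 1 ≤ r)
    (hN : 0 < N) (hη : 0 ≤ η) (he : 0 < e) (hS : 0 < S) (hSB : S ≤ B₀) (hW : |W| ≤ B₀) (hW' : |W'| ≤ B₀) (hS' : |S'| ≤ B₀)
    (hWS : W + S ≤ 1) :
    3 / 2 * (N * (1 + 4 * S)) ≤
      (Λ - (2 / 3 * W' + 2 * W - r - 2 * S' - 4 * S)) * (N / Λ * (2 + 75 * S) + η * e)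
        - (W - 1 - S) * (N / Λ * (75 * S') + η * e) - |W' / 3 - S' - 2 * S| * (N / Λ * (2 + 100 * S) + η * e) := by
  obtain ⟨hWl, hWu⟩ := abs_le.1 hW
  obtain ⟨hW'l, hW'u⟩ := abs_le.1 hW'
  obtain ⟨hS'l, hS'u⟩ := abs_le.1 hS'
  have hB2 : B₀ ≤ B₀ ^ 2 := by nlinarith
  have hΛpos : 0 < Λ := by nlinarith
  have hNΛ : 0 < N / Λ := div_pos hN hΛpos
  have hb : |W' / 3 - S' - 2 * S| ≤ 4 * B₀ := by
    have e1 : W' / 3 - S' - 2 * S = W' / 3 + -S' + -(2 * S) := by ring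
    rw [e1]
    calc _ ≤ |W' / 3| + |(-S')| + |(-(2 * S))| := abs_add_three _ _ _
      _ ≤ 4 * B₀ := by
        rw [abs_neg, abs_neg, abs_of_pos (by positivity : (0:ℝ) < 2 * S)]
        have : |W' / 3| ≤ B₀ / 3 := by rw [abs_div, abs_of_pos (by norm_num : (0:ℝ) < 3)]; linarith
        have : |S'| ≤ B₀ := hS'
        linarith
  have hbmm : 2 / 3 * W' + 2 * W - r - 2 * S' - 4 * S ≤ 10 * B₀ := by linarith
  have hEN : 3 / 2 * Λ * (1 + 4 * S) ≤ (Λ - (2 / 3 * W' + 2 * W - r - 2 * S' - 4 * S)) * (2 + 75 * S)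
      - (W - 1 - S) * (75 * S') - 4 * B₀ * (2 + 100 * S) := by
    have t1 : (Λ - 10 * B₀) * (2 + 75 * S) ≤ (Λ - (2 / 3 * W' + 2 * W - r - 2 * S' - 4 * S)) * (2 + 75 * S) :=
      mul_le_mul_of_nonneg_right (by linarith) (by positivity)
    have t2 : |(W - 1 - S) * (75 * S')| ≤ 3 * B₀ * (75 * B₀) := by
      rw [abs_mul]
      refine mul_le_mul (by rw [abs_le]; constructor <;> linarith) ?_ (abs_nonneg _) (by positivity)
      rw [abs_mul, abs_of_pos (by norm_num : (0:ℝ) < 75)]; linarith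
    have t2' := (abs_le.1 t2).1
    have t3 : S * (69 * Λ - 1150 * B₀) ≥ 0 := mul_nonneg hS.le (by nlinarith)
    nlinarith
  have hEη : 0 ≤ e * ((Λ - (2 / 3 * W' + 2 * W - r - 2 * S' - 4 * S)) - (W - 1 - S) - 4 * B₀) := by
    have : 0 ≤ (Λ - (2 / 3 * W' + 2 * W - r - 2 * S' - 4 * S)) - (W - 1 - S) - 4 * B₀ := by nlinarith
    positivity
  have hcoup : |W' / 3 - S' - 2 * S| * (N / Λ * (2 + 100 * S) + η * e) ≤ 4 * B₀ * (N / Λ * (2 + 100 * S) + η * e) :=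
    mul_le_mul_of_nonneg_right hb (by positivity)
  have h1 : N / Λ * (3 / 2 * Λ * (1 + 4 * S)) = 3 / 2 * (N * (1 + 4 * S)) := by field_simp
  have h2 : N / Λ * (3 / 2 * Λ * (1 + 4 * S)) ≤ N / Λ * ((Λ - (2 / 3 * W' + 2 * W - r - 2 * S' - 4 * S)) * (2 + 75 * S)
          - (W - 1 - S) * (75 * S') - 4 * B₀ * (2 + 100 * S)) := mul_le_mul_of_nonneg_left hEN hNΛ.le
  have h3 : 0 ≤ η * (e * ((Λ - (2 / 3 * W' + 2 * W - r - 2 * S' - 4 * S)) - (W - 1 - S) - 4 * B₀)) :=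
    mul_nonneg hη hEη
  nlinarith

/-! ## The arithmetic of the outer touching cases -/

/-- **`P` OR `M` TOUCHES (interior point, or `P` at the outflow endpoint `x_Λ`): `θ ≤ 1`.** The touching inequality
`θ·slack ≤ A` (`A = N(1 + 4S) ≥ |F±|`, slack `= (Λ − b)ȳ − cȳ′ − |coupling|·ȳ_other` after moving the coupling
`|b∓||other| ≤ θ|b∓|ȳ_other` to the left) together with `slack ≥ (3/2)A − J`, `J ≤ A/4` gives `θ ≤ 4/5`. [folklore] -/
theorem outer_touch_arith {θ A slack J : ℝ} (hθ : 0 ≤ θ) (hA : 0 < A) (hslack : 3 / 2 * A - J ≤ slack) (hJ : J ≤ A / 4)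
    (hT : θ * slack ≤ A) : θ ≤ 1 := by
  have h1 : θ * (5 / 4 * A) ≤ θ * slack := mul_le_mul_of_nonneg_left (by linarith) hθ
  have h2 : θ * (5 / 4) * A ≤ 1 * A := by linarith
  have h3 := le_of_mul_le_mul_right h2 hA
  linarith

/-- **Registered helper `packingResolventW_outerSlack` of `stub_packingResolventW`** (= `outer_BP_zoneA` in the registered
`∀`-form): the slack of the `P`-barrier `(N/Λ)(2 + 100S) + ηeˣ` against the coupling to `M̄ = (N/Λ)(2 + 75S) + ηeˣ` on the
near-centre zone `x_Λ ≤ x ≤ 0` of the outer region. [folklore] -/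
theorem packingResolventW_outerSlack : ∀ (Λ r W W' S S' N η e : ℝ), 1000 ≤ Λ → 1 ≤ r → 0 < N → 0 ≤ η → 0 < e → e ≤ 1 → S * e ≤ 1 → 0 < S → 175 * S ≤ 94 * Λ - 902 → |W| ≤ 1 / 4 → |W'| ≤ 1 / 2 → |S + S'| ≤ 11 / 5 → 3 / 2 * (N * (1 + 4 * S)) - 13 * η ≤ (Λ - (2 / 3 * W' + 2 * W - r + 2 * S' + 4 * S)) * (N / Λ * (2 + 100 * S) + η * e) - (W - 1 + S) * (N / Λ * (100 * S') + η * e) - |W' / 3 + S' + 2 * S| * (N / Λ * (2 + 75 * S) + η * e) := by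
  intro Λ r W W' S S' N η e hΛ hr1 hN hη he he1 hSe hS hSmax hW hW' hτ
  exact outer_BP_zoneA hΛ hr1 hN hη he he1 hSe hS hSmax hW hW' hτ

end Summit.AtomisticToContinuum.HydrodynamicLimit.Theorems.PackingAnalyticImplosion
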